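import Literature.Computability.Cryptography.HallgrenPell
import Literature.Computability.Cryptography.UnitResidueSim
import Literature.Computability.Complexity.CodeFPStrings
import HarnessLib

/-!
# Proof of `JacobsonWilliams2008_unitResidue_mem_FP`

Topic `Computability/Cryptography`. The named fact `JacobsonWilliams2008_unitResidue_mem_FP` of
`HallgrenPell.lean` (Jacobson–Williams 2009, Ch. 12: from an integer within `1` of the regulator
`R = ln ε₀` of `ℚ(√d)` to the fundamental unit `ε₀ = (a + b√d)/2` modulo `m`, in classical polynomial
time) is discharged here by assembling

* the abstract algorithm `UnitResidue.algo` and its correctness `UnitResidue.algo_eq`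
  (`UnitResidueMain.lean`: infrastructure of `𝒪_Δ`, baby steps with floating-point distances, the
  binary ladder of squarings/reductions of Algorithm 12.6 `CR`, the final walk to `ε₀`, coordinates
  kept exactly);
* the register program `UnitResidue.prog` computing it with the coordinates of `θ` reduced modulo `m`
  and every register polynomially bounded (`UnitResidueMachine.lean`, `UnitResidueSim.run_prog`);
* the typed polynomial-time algebra `CodeFP` (`Complexity/CodeFPRegs.lean`: every register program
  with clamped loops is `CodeFP`), with the parameter `N = 64 · |input|` read off the input length.

Main result: `JacobsonWilliams2008_unitResidue_mem_FP_holds`.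

## References

* M. J. Jacobson Jr., H. C. Williams, *Solving the Pell Equation*, CMS Books in Mathematics, Springer
  2009, Ch. 12 (§12.2 Alg. 12.6 CR, §12.3), §5.3–5.4, §7.4. [JacobsonWilliams2008]
* S. Arora, B. Barak, *Computational Complexity: A Modern Approach*, CUP 2009, §1.3. [AroraBarak2009]
-/

noncomputable section

open scoped Classical

namespace Literature.Computability.Cryptography

namespace UnitResidue

open Literature.Computability.Complexity Literature.Computability.Complexity.CodeFP
  Literature.Computability.Complexity.RegProg Literature.NumberTheory.QuadraticFields.Infra
  _root_.Computability

/-- `|⟨bin d, ⟨bin r, bin m⟩⟩| = 2|d| + 2|r| + |m| + 4`. [folklore] -/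
theorem length_inE (x : ℕ × ℕ × ℕ) :
    (pairE natE (pairE natE natE) x).length = 2 * Nat.size x.1 + 2 * Nat.size x.2.1 + Nat.size x.2.2 + 4 := by
  obtain ⟨d, r, m⟩ := x
  simp only [pairE_apply, length_boolPair, length_natE]; ring

/-- `n ≤ |x| ≤ 2n` for the input length. [folklore] -/
theorem nOf_le_length (d r m : ℕ) :
    nOf d r m ≤ (pairE natE (pairE natE natE) (d, r, m)).length ∧ (pairE natE (pairE natE natE) (d, r, m)).length ≤ 2 * nOf d r m := by
  rw [length_inE]; unfold nOf; simp only; omega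

/-- **The run parameter `N = 64|x|` (unary) and the initial register file, on codes.**
[cite: AroraBarak2009, §1.3] -/
theorem codeFP_init : CodeFP (pairE natE (pairE natE natE)) stE (fun x => (64 * (pairE natE (pairE natE natE) x).length, (MS.init x.1 x.2.1 x.2.2).lay)) := by
  have hstr : CodeFP (pairE natE (pairE natE natE)) strE (fun x => pairE natE (pairE natE natE) x) := ⟨id, PolyTimeComputable.id _, fun _ => rfl⟩
  have hN : CodeFP (pairE natE (pairE natE natE)) unE (fun x => 64 * (pairE natE (pairE natE natE) x).length) := (unMulConst 64).comp (strLength.comp hstr)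
  have hd : CodeFP (pairE natE (pairE natE natE)) intE (fun x => (x.1 : ℤ)) := intOfNat.comp (fst _ _)
  have hr : CodeFP (pairE natE (pairE natE natE)) intE (fun x => (x.2.1 : ℤ)) := intOfNat.comp (snd _ _).fst'
  have hm : CodeFP (pairE natE (pairE natE natE)) intE (fun x => (x.2.2 : ℤ)) := intOfNat.comp (snd _ _).snd'
  have hz : CodeFP (pairE natE (pairE natE natE)) (rawE intE)
      (fun _ => ([0, 0, 0, 0, 0, 0, 0, 0, 0, 0, 0, 0, 0, 0, 0, 0, 0, 0, 0, 0, 0, 0] : List ℤ)) := const _ _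
  have hregs : CodeFP (pairE natE (pairE natE natE)) (rawE intE) (fun x => (MS.init x.1 x.2.1 x.2.2).lay) :=
    ((rawCons intE).comp (hd.pair ((rawCons intE).comp (hr.pair ((rawCons intE).comp (hm.pair hz)))))).congr
      fun x => rfl
  exact hN.pair hregs

/-- **The whole machine on codes**: parameter, program, the two output registers as naturals.
[cite: AroraBarak2009, §1.3] -/
theorem codeFP_machine : CodeFP (pairE natE (pairE natE natE)) (pairE natE natE)
    (fun x => (((prog.run (64 * (pairE natE (pairE natE natE) x).length) (MS.init x.1 x.2.1 x.2.2).lay).getD 23 0).toNat,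
      ((prog.run (64 * (pairE natE (pairE natE natE) x).length) (MS.init x.1 x.2.1 x.2.2).lay).getD 24 0).toNat)) := by
  have hrun : CodeFP (pairE natE (pairE natE natE)) (rawE intE) (fun x => prog.run (64 * (pairE natE (pairE natE natE) x).length) (MS.init x.1 x.2.1 x.2.2).lay) :=
    (prog.code.comp codeFP_init).congr fun x => rfl
  have hget : ∀ i : ℕ, CodeFP (pairE natE (pairE natE natE)) natE
      (fun x => ((prog.run (64 * (pairE natE (pairE natE natE) x).length) (MS.init x.1 x.2.1 x.2.2).lay).getD i 0).toNat) := fun i =>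
    (intToNat.comp ((rawGetOr intE).comp (hrun.pair ((const (pairE natE (pairE natE natE)) i).pair (const (pairE natE (pairE natE natE)) (0 : ℤ)))))).congr
      fun x => rfl
  exact (hget 23).pair (hget 24)

/-- The output registers in the register file. [folklore] -/
theorem getD_lay_ox (S : MS) : S.lay.getD 23 0 = S.ox := rfl
/-- The output registers in the register file. [folklore] -/
theorem getD_lay_oy (S : MS) : S.lay.getD 24 0 = S.oy := rfl

end UnitResidue

open Literature.Computability.Complexity Literature.Computability.Complexity.CodeFP
  Literature.Computability.Cryptography.UnitResidue Literature.NumberTheory.QuadraticFields.Infra _root_.Computability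

/-- **Jacobson–Williams, *Solving the Pell Equation*, Ch. 12: the fundamental unit modulo `m` from the
integer part of the regulator, in classical polynomial time** — the named fact
`JacobsonWilliams2008_unitResidue_mem_FP`, proved. The `FP` function is the register program
`UnitResidue.prog` (the infrastructure walk/ladder of Algorithm 12.6 with `(θ mod m)`-coordinates) run
with parameter `N = 64 · |input|`; on inputs satisfying the promise its output registers hold
`UnitResidue.algo d r m N = (a mod m, b mod m)` (`UnitResidue.run_prog`, `UnitResidue.algo_eq`).
[cite: JacobsonWilliams2008, Ch. 12: §12.2 Algorithm 12.6 (CR), §12.3; §5.3 Thm 5.18, §5.4, §7.4] -/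
theorem JacobsonWilliams2008_unitResidue_mem_FP_holds : JacobsonWilliams2008_unitResidue_mem_FP := by
  obtain ⟨f, hf, hfx⟩ := codeFP_machine
  refine ⟨f, hf, fun d r m a b hd h2 hm hb hab hmin hr => ?_⟩
  obtain ⟨hn1, hn2⟩ := nOf_le_length d r m
  have C : RunCtx d r m (64 * (pairE natE (pairE natE natE) (d, r, m)).length) := ⟨hd, h2, hm, by omega, by omega⟩
  obtain ⟨S', hrunS, hox, hoy⟩ := run_prog C
  have halg : algo d r m (64 * (pairE natE (pairE natE natE) (d, r, m)).length) = (a % m, b % m) :=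
    algo_eq hd h2 hb hab hmin hr C.hN C.hN'
  show f (pairE natE (pairE natE natE) (d, r, m)) = pairE natE natE (a % m, b % m)
  rw [hfx]
  congr 1
  dsimp only
  rw [hrunS, getD_lay_ox, getD_lay_oy, hox, hoy, Int.toNat_natCast, Int.toNat_natCast, halg]

end Literature.Computability.Cryptography
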